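import Literature.AlgebraicGeometry.ModuliOfAbelianVarieties.SiegelModuliComplexUniformisation
import Literature.AlgebraicGeometry.Motives.ComplexPointsManifold
import Literature.AlgebraicGeometry.Motives.BaseChange
import HarnessLib

/-!
# THICK complex points of a smooth open piece of a Siegel fine moduli scheme (the E-road's thickness predicate)
# ([LangeBirkenhake1992] Ch. 8 §8.1–8.2: the period map of a family; [MumfordFogartyKirwan1994] App. 7A)

Topic `Literature/AlgebraicGeometry/ModuliOfAbelianVarieties`, namespace
`Literature.AlgebraicGeometry.ModuliOfAbelianVarieties.EquidimOfF` (the token every consumer already types).  STATEMENT-LEVEL FILE: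
two parametrised `Prop`-valued PREDICATES (definitions with explicit parameters — not named facts, D-0014 clean) and the
`Iff.rfl` unfolding theorem; no instance, no notation, no `sorry`.  Cell `hodgecm-mathlib` (D-0151), E-road «EQUIDIM by proof»
(skeleton `Cruxes/HDel/Lines/EquidimOfF.lean`, residual `stub_noThinPiece`), Hecke-link line card v1.1: the thickness currency in which
sockets (A) `SocketThickLinkedLift` / (B) `SocketQuotientMap`, the transfer (T2) and the bridge THICK ⇔ NOT THIN are typed (B-p01 (g13)
cert v9 / probe v5; consumers ★ `EquidimThickLift` (B-p08 (g9)), (A4) B-p13 (g16), H4 B-p14 (g14)/B-p21 (g14)).  HC_CM is proved only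
modulo the 7 printed citations until rung 0 closes.

For a Siegel fine moduli scheme `𝓜` (level `N`, type `δ`), a morphism `ι : S′ ⟶ 𝓜_ℂ` from a `ℂ`-scheme smooth of relative dimension
`d`, a complex point `t` of `S′` and a finite-adelic representative `r`:
* `IsThickAtWith hδ 𝓜 ι d t r` — around `t` there is a LOCAL PERIOD MAP in the sense of the P4-piece theorem (★
  `UeP4OfFPiece.ue_P4_piece_of_F`: an open `W ∋ t`, `π : S′(ℂ) → M_g(ℂ)` continuous on `W`, entrywise holomorphic in every algebraic
  chart of `S′(ℂ)` at points of `W`, reading admissibility AT `r` at triples classified by `ι x`), AND at every scale the image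
  `π(W ∩ (chart at t).source ∩ U)` of every open `U ∋ t` contains a non-empty open subset of `𝔥_g` (a GERM property at `t`);
* `IsThickAt hδ 𝓜 ι d t` — the same for SOME principal representative `r ∈ K_δ(1)`;
* `isThickAt_iff` — the unfolding (`Iff.rfl`).
On a piece of relative dimension `d`, THICK at `t` ⇔ `g(g+1)/2 ≤ d` (★-bound `Theorems/EquidimThickIffLe`, invariance of domain both ways).

## References
* [LangeBirkenhake1992] H. Lange, Ch. Birkenhake, *Complex Abelian Varieties* (1992), Ch. 8 §8.1–8.2 (period matrices of families).
* [MumfordFogartyKirwan1994] D. Mumford, J. Fogarty, F. Kirwan, *Geometric Invariant Theory* (3rd ed. 1994), Appendix to Ch. 7 §A (p. 235).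
-/


noncomputable section

open CategoryTheory CategoryTheory.Limits AlgebraicGeometry Matrix Topology
open Literature.AlgebraicGeometry.Motives (SchemeOver ComplexPoints AlgPoints specOver)
open Literature.AlgebraicGeometry.AbelianSchemes (PolarizedAbelianSchemeWithLevel)
open Literature.NumberTheory.Automorphic (siegelUpperHalfSpace)
open Literature.NumberTheory.Adeles

namespace Literature.AlgebraicGeometry.ModuliOfAbelianVarieties

open SiegelModuli

namespace EquidimOfF

variable {g N : ℕ} {δ : Fin g → ℕ}

/-- **A complex point `t` of a smooth open piece `ι : S′ ⟶ 𝓜_ℂ` (relative dimension `d`) is THICK WITH RESPECT TO THE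
REPRESENTATIVE `r`**: around `t` there is a local period map as in the P4-piece socket — an open `W ∋ t`, `π : S′(ℂ) → M_g(ℂ)`
continuous on `W`, entrywise holomorphic in every algebraic chart of `S′(ℂ)` at points of `W`, reading admissibility at `r` at
triples classified by `ι x` — AND, AT EVERY SCALE, the image `π(W ∩ source of the algebraic chart at t ∩ U)` of every open `U ∋ t`
contains a non-empty open subset of `𝔥_g` (a GERM property at `t`).  The representative `r` is an ARGUMENT (sockets-first finding of
B-p03 (g15): period compatibilities must be stated at ONE representative, admissibility being invariant under the rational moves
`(Z, r) ↦ (γ • Z, γ r)`).  Statement-valued `def` (HOME). [cite: LangeBirkenhake1992, Ch. 8 §8.1–8.2]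
[cite: MumfordFogartyKirwan1994, Appendix to Ch. 7 §A (p. 235)] -/
def IsThickAtWith (hδ : IsPolarizationType δ) (𝓜 : SiegelFineModuliScheme g N δ) {S' : SchemeOver ℂ}
    (ι : S' ⟶ (Motives.baseChange ℚ ℂ).obj 𝓜.M) (d : ℕ) [SmoothOfRelativeDimension d S'.hom]
    (t : ComplexPoints S') (r : gspFinAdelic δ) : Prop :=
  haveI : IsLocallyNoetherian (specOver ℚ ℂ).left := inferInstanceAs (IsLocallyNoetherian (Spec (CommRingCat.of ℂ)))
  haveI : Smooth S'.hom := SmoothOfRelativeDimension.smooth d _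
  haveI : LocallyOfFiniteType S'.hom := inferInstance
  ∃ (W : Set (ComplexPoints S')) (π : ComplexPoints S' → Matrix (Fin g) (Fin g) ℂ),
    IsOpen W ∧ t ∈ W ∧ ContinuousOn π W ∧
    (∀ x ∈ W, ∀ (i j : Fin g),
      DifferentiableOn ℂ ((fun y ↦ π y i j) ∘ (ComplexPoints.algebraicChart S' d x).symm)
        ((ComplexPoints.algebraicChart S' d x).target ∩ (ComplexPoints.algebraicChart S' d x).symm ⁻¹' W)) ∧
    (∀ x ∈ W, ∃ hx : π x ∈ siegelUpperHalfSpace g,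
      ∃ P' : PolarizedAbelianSchemeWithLevel g N δ (specOver ℚ ℂ).left,
        IsAdmissibleAt hδ r (π x) hx P' ∧
        AlgPoints.baseChangeEquiv (algebraMap ℚ ℂ) 𝓜.M (𝓜.classifyingMap (specOver ℚ ℂ) P') = AlgPoints.map (L := ℂ) ι x) ∧
    ∀ U : Set (ComplexPoints S'), IsOpen U → t ∈ U →
      ∃ V : Set (siegelUpperHalfSpace g), IsOpen V ∧ V.Nonempty ∧
        Subtype.val '' V ⊆ π '' (W ∩ (ComplexPoints.algebraicChart S' d t).source ∩ U)

/-- **A complex point `t` of a smooth open piece is THICK**: `IsThickAtWith … t r` for SOME principal representative `r ∈ K_δ(1)`.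
[cite: LangeBirkenhake1992, Ch. 8 §8.1–8.2] [cite: MumfordFogartyKirwan1994, Appendix to Ch. 7 §A (p. 235)] -/
def IsThickAt (hδ : IsPolarizationType δ) (𝓜 : SiegelFineModuliScheme g N δ) {S' : SchemeOver ℂ}
    (ι : S' ⟶ (Motives.baseChange ℚ ℂ).obj 𝓜.M) (d : ℕ) [SmoothOfRelativeDimension d S'.hom]
    (t : ComplexPoints S') : Prop :=
  ∃ (r : gspFinAdelic δ) (_ : r ∈ principalLevelSubgroup δ 1), IsThickAtWith hδ 𝓜 ι d t r

/-- `IsThickAt` unfolds to «thick with respect to SOME principal representative» (by `Iff.rfl`; consumers destructure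
`⟨r, hr, h⟩` / rebuild `⟨r, hr, h⟩`). [cite: LangeBirkenhake1992, Ch. 8 §8.1] -/
theorem isThickAt_iff (hδ : IsPolarizationType δ) (𝓜 : SiegelFineModuliScheme g N δ) {S' : SchemeOver ℂ}
    (ι : S' ⟶ (Motives.baseChange ℚ ℂ).obj 𝓜.M) (d : ℕ) [SmoothOfRelativeDimension d S'.hom] (t : ComplexPoints S') :
    IsThickAt hδ 𝓜 ι d t ↔
      ∃ (r : gspFinAdelic δ) (_ : r ∈ principalLevelSubgroup δ 1), IsThickAtWith hδ 𝓜 ι d t r :=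
  Iff.rfl

end EquidimOfF

end Literature.AlgebraicGeometry.ModuliOfAbelianVarieties

end
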